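import Literature.AlgebraicGeometry.Frobenioids.Prop25SubFourFold
import Literature.AlgebraicGeometry.Frobenioids.Prop25SubFourFoldUnique
import Literature.AlgebraicGeometry.Frobenioids.Prop25SubSplitting
import Mathlib.CategoryTheory.Conj
import HarnessLib

/-!
# [FrdI] Proposition 2.5 (iii), sub-DAG row P25-L04 — `Ψ(φ)` is well defined: discharge of
# `FrdI.P25.PsiMapWellDefined`

Mochizuki, *The geometry of Frobenioids I: the general theory*, Kyushu J. Math. **62** (2008)
293–400, §2, proof of Proposition 2.5 (iii), p. 50 ll. 2–6 [cite: MochizukiFrdI2008, Prop. 2.5(iii) p.50]: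
"Then it follows immediately from the functoriality of the characteristic splitting `τ(−)` that for any
isomorphism `ε : A′ ⥲ A` in `C`, `β′ ∈ O^×(A)`, we have `Ψ(ε⁻¹ ∘ β ∘ β′ ∘ ε) = ε⁻¹ ∘ Ψ(β) ∘ β′ ∘ ε`.
This implies immediately that `Ψ(φ)` is independent of the choice of factorization
`φ = α ∘ β ∘ γ ∘ δ`."
PROOF-ONLY companion of `Prop25Sub.lean` (row P25-L04, holder/typer abc-iut-L1-t2): existence of a
`Ψ`-value from rows L01 (`fourFoldFactorisation_holds`), Def. 1.3 (vii)(a) (hulls) and L03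
(`splittingAtAnyObject_holds`); uniqueness from row L02 (`fourFoldFactorisationUnique_holds`), the
transport of the splitting along the isomorphism `ε` of middle objects (functoriality of `τ`, field
`res_mem`, through the induced isomorphism of isotropic hulls) and the uniqueness of the splitting
(row L03), plus commutativity of `O^▷` (Rem. 1.3.1).  No new definitions.
-/

namespace Literature.AlgebraicGeometry.Frobenioids

open CategoryTheory Opposite

namespace FrdI.P25

open PreFrobenioid

universe w v v' u u'

variable {D : Type u} [Category.{v} D] {Φ : Dᵒᵖ ⥤ CommMonCat.{w}}
  {C : Type u'} [Category.{v'} C] {F : C ⥤ ElemFrobenioid Φ}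

/-- Isotropic hulls of isomorphic objects are isomorphic, compatibly with the hulls (Def. 1.3 (vii)(a):
"necessarily unique, up to unique isomorphism"). [cite: MochizukiFrdI2008, Def. 1.3(vii) p.25] -/
theorem exists_hullIso {Y Y' Yi Yi' : C} {h : Y ⟶ Yi} {h' : Y' ⟶ Yi'} (hh : IsIsotropicHull F h)
    (hh' : IsIsotropicHull F h') (ε : Y' ≅ Y) : ∃ εi : Yi' ≅ Yi, h' ≫ εi.hom = ε.hom ≫ h := by
  obtain ⟨f, hf, -⟩ := hh'.2.2.2 (ε.hom ≫ h) hh.2.2.1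
  obtain ⟨g, hg, -⟩ := hh.2.2.2 (ε.inv ≫ h') hh'.2.2.1
  have hfg : f ≫ g = 𝟙 _ := by
    obtain ⟨x, -, hx⟩ := hh'.2.2.2 h' hh'.2.2.1
    rw [hx (f ≫ g) (by show h' ≫ f ≫ g = h'; rw [reassoc_of% hf, hg, ε.hom_inv_id_assoc]),
      hx (𝟙 _) (Category.comp_id _)]
  have hgf : g ≫ f = 𝟙 _ := by
    obtain ⟨x, -, hx⟩ := hh.2.2.2 h hh.2.2.1
    rw [hx (g ≫ f) (by show h ≫ g ≫ f = h; rw [reassoc_of% hg, hf, ε.inv_hom_id_assoc]),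
      hx (𝟙 _) (Category.comp_id _)]
  exact ⟨⟨f, g, hfg, hgf⟩, hf⟩

/-- Transport of "`β₁` lies in `τ` via a hull" along an isomorphism of the objects (functoriality of `τ`
along the induced isomorphism of hulls, Def. 2.3 + Prop. 2.2 (ii)). [cite: MochizukiFrdI2008, Def. 2.3 p.47] -/
theorem inTauVia_conj (τ : CharacteristicSplitting F) {Y Y' Yi Yi' : C} {h : Y ⟶ Yi} {h' : Y' ⟶ Yi'}
    (hh : IsIsotropicHull F h) (hh' : IsIsotropicHull F h') (ε : Y' ≅ Y) {β₁ : Y ⟶ Y}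
    (ht : InTauVia τ h β₁) : InTauVia τ h' (ε.hom ≫ β₁ ≫ ε.inv) := by
  obtain ⟨εi, hεi⟩ := exists_hullIso hh hh' ε
  obtain ⟨t, htτ, hht⟩ := ht
  have htm : (t : End Yi) ∈ endSubmonoid F Yi := τ.τ_le hh.2.2.1 htτ
  refine ⟨εi.hom ≫ t ≫ εi.inv, ?_, ?_⟩
  · refine τ.res_mem hh'.2.2.1 hh.2.2.1 εi.hom (isLinear_of_isIso F εi.hom) t htτ _ ⟨?_, ?_⟩ ?_
    · show Base F (εi.hom ≫ t ≫ εi.inv) = 𝟙 _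
      rw [base_comp, base_comp, show Base F t = 𝟙 _ from htm.1, Category.id_comp, ← base_comp,
        εi.hom_inv_id, base_id]
    · exact IsLinear.comp F (isLinear_of_isIso F εi.hom)
        (IsLinear.comp F htm.2 (isLinear_of_isIso F εi.inv))
    · show εi.hom ≫ t = (εi.hom ≫ t ≫ εi.inv) ≫ εi.hom
      simp
  · have e : h ≫ εi.inv = ε.inv ≫ h' := by
      rw [← cancel_epi ε.hom, ε.hom_inv_id_assoc, ← reassoc_of% hεi, εi.hom_inv_id, Category.comp_id]
    calc h' ≫ εi.hom ≫ t ≫ εi.inv = ε.hom ≫ (h ≫ t) ≫ εi.inv := by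
          rw [← Category.assoc, hεi]; simp only [Category.assoc]
      _ = ε.hom ≫ β₁ ≫ (h ≫ εi.inv) := by rw [hht]; simp only [Category.assoc]
      _ = (ε.hom ≫ β₁ ≫ ε.inv) ≫ h' := by rw [e]; simp only [Category.assoc]

/-- **Row P25-L04 `PsiMapWellDefined` DISCHARGED**: every arrow has exactly one `Ψ`-value.
[cite: MochizukiFrdI2008, Prop. 2.5(iii) p.50] -/
theorem psiMapWellDefined_holds (τ : CharacteristicSplitting F) (d : ℕ+) : PsiMapWellDefined F τ d := by
  intro hS A B φ
  have hF := hS.isFrobenioid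
  have hP := hF.isPreFrobenioid
  -- existence
  obtain ⟨X, Y, δ, γ, β, α, h4⟩ := fourFoldFactorisation_holds (F := F) hS φ
  obtain ⟨Yi, h, hh⟩ := hF.vii_a Y
  obtain ⟨⟨β₀, β₁⟩, ⟨hβ₀, hβ₁, hτ, hsp⟩, -⟩ :=
    splittingAtAnyObject_holds (F := F) τ hS h hh β h4.2.2.1
  refine ⟨δ ≫ γ ≫ ((show End Y from β₁) ^ (d : ℕ) : End Y) ≫ β₀.hom ≫ α,
    ⟨X, Y, Yi, δ, γ, β, α, h, β₀, β₁, h4, hh, hβ₀, hβ₁, hτ, hsp, rfl⟩, ?_⟩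
  -- uniqueness
  rintro ψ' ⟨X', Y', Yi', δ', γ', β', α', h', β₀', β₁', h4', hh', hβ₀', hβ₁', hτ', hsp', rfl⟩
  obtain ⟨θ, ε, u, hu, hδ', hγ', hβ', hα'⟩ :=
    fourFoldFactorisationUnique_holds (F := F) hS φ δ γ β α δ' γ' β' α' h4 h4'
  -- the transported splitting of `β'` at `Y'`
  have hcomm : u.hom ≫ β₁ = β₁ ≫ u.hom :=
    congrArg Subtype.val (endSubmonoid_comm F hF ⟨β₁, hβ₁⟩ ⟨u.hom, hu⟩)
  let W : Aut Y' := ε ≪≫ (u ≪≫ β₀) ≪≫ ε.symm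
  have hW : W ∈ unitsSubgroup F Y' := by
    refine ⟨?_, isLinear_of_isIso F W.hom⟩
    show Base F (ε.hom ≫ (u.hom ≫ β₀.hom) ≫ ε.inv) = 𝟙 _
    rw [base_comp, base_comp, base_comp, show Base F u.hom = 𝟙 _ from hu.1,
      show Base F β₀.hom = 𝟙 _ from hβ₀.1, Category.id_comp, Category.id_comp, ← base_comp,
      ε.hom_inv_id, base_id]
  have hB₁ : ((ε.hom ≫ β₁ ≫ ε.inv : Y' ⟶ Y') : End Y') ∈ endSubmonoid F Y' := by
    refine ⟨?_, ?_⟩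
    · show Base F (ε.hom ≫ β₁ ≫ ε.inv) = 𝟙 _
      rw [base_comp, base_comp, show Base F β₁ = 𝟙 _ from hβ₁.1, Category.id_comp, ← base_comp,
        ε.hom_inv_id, base_id]
    · exact IsLinear.comp F (isLinear_of_isIso F ε.hom)
        (IsLinear.comp F hβ₁.2 (isLinear_of_isIso F ε.inv))
  have hsplit' : β' = (ε.hom ≫ β₁ ≫ ε.inv) ≫ W.hom := by
    rw [hβ', hsp]
    show (ε.hom ≫ u.hom) ≫ (β₁ ≫ β₀.hom) ≫ ε.inv = (ε.hom ≫ β₁ ≫ ε.inv) ≫ ε.hom ≫ (u.hom ≫ β₀.hom) ≫ ε.inv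
    simp only [Category.assoc, Iso.inv_hom_id_assoc]
    rw [reassoc_of% hcomm]
  obtain ⟨p, -, hpuniq⟩ := splittingAtAnyObject_holds (F := F) τ hS h' hh' β' h4'.2.2.1
  have e₁ : (β₀', β₁') = p := hpuniq _ ⟨hβ₀', hβ₁', hτ', hsp'⟩
  have e₂ : (W, ε.hom ≫ β₁ ≫ ε.inv) = p :=
    hpuniq _ ⟨hW, hB₁, inTauVia_conj τ hh hh' ε hτ, hsplit'⟩
  have e := e₁.trans e₂.symm
  have eβ₀ : β₀' = W := congrArg Prod.fst e
  have eβ₁ : β₁' = ε.hom ≫ β₁ ≫ ε.inv := congrArg Prod.snd e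
  -- compare the two values
  have hpow : ((show End Y' from β₁') ^ (d : ℕ) : End Y') =
      ε.hom ≫ ((show End Y from β₁) ^ (d : ℕ) : End Y) ≫ ε.inv := by
    rw [eβ₁]
    have := ε.symm.conj_pow (show End Y from β₁) d
    rw [Iso.conj_apply, Iso.conj_apply] at this
    simpa using this.symm
  have hcommd : u.hom ≫ ((show End Y from β₁) ^ (d : ℕ) : End Y) =
      ((show End Y from β₁) ^ (d : ℕ) : End Y) ≫ u.hom := by
    have := endSubmonoid_comm F hF (⟨β₁, hβ₁⟩ ^ (d : ℕ)) ⟨u.hom, hu⟩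
    exact congrArg Subtype.val this
  rw [hδ', hγ', hpow, eβ₀, hα']
  show (δ ≫ θ.inv) ≫ (θ.hom ≫ γ ≫ u.inv ≫ ε.inv) ≫ (ε.hom ≫ _ ≫ ε.inv) ≫
      (ε.hom ≫ (u.hom ≫ β₀.hom) ≫ ε.inv) ≫ ε.hom ≫ α = δ ≫ γ ≫ _ ≫ β₀.hom ≫ α
  simp only [Category.assoc, Iso.inv_hom_id_assoc]
  rw [← reassoc_of% hcommd, Iso.inv_hom_id_assoc]

end FrdI.P25

end Literature.AlgebraicGeometry.Frobenioids
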